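import Summits.Ventures.CertifiedManyBodySolver.Rows.HomTorusMagModel
import Summits.Ventures.CertifiedManyBodySolver.Rows.TorusCeilingCRT
import Mathlib.Analysis.SpecialFunctions.Complex.Circle
import HarnessLib

/-!
# Torus ceiling — Part IX: the one-seam (ED) form of the uniformly twisted CRT rings

HONEST FRAMING: first certified bounds; not a superconductivity verdict; every number certified or
labelled float.
Part VIII (`TorusCeilingHomTwist.lean`) bounds, from a window certificate, the sector ground energies of
the Peierls Hamiltonians `homHubbardMag crtHom35 (fun _ => κ) t U` (ring `ℤ/15 ≅ ℤ/3 × ℤ/5`, hops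
`+10 ≙ e_x`, `+6 ≙ e_y`) with a UNIFORM field `κ = (κ₀, κ₁) ∈ U(1)²`, and likewise on `crtHom34`
(`ℤ/12 ≅ 3 × 4`) and on the transposed presentations `crtHom53`, `crtHom43`.
Exact-diagonalisation references use the ONE-SEAM convention instead: phase `e^{iθ_x}` on the `x`-bonds
leaving the last column, `e^{iθ_y}` on the `y`-bonds leaving the last row, `1` elsewhere (`crtSeam`).
This file is the kernel dictionary between the two: the lattice gauge transformation by the
CRT-coordinate gauge `g(s) = κ₀^{s mod a} κ₁^{s mod b}` (`crtGauge`) carries the uniform field to the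
one-seam field with seam phases `(κ₀^a, κ₁^b)` (`homGaugeTransform_crtGauge_crtHom35/34/53/43`, a
residue computation closed by `omega`), gauge transformations preserve every `(N, S^z)`-sector minimum
(Part VI, `minEnergyOn_szSector_homGaugeTransform`), and every pair of seam phases is such a pair of
powers (`exists_pow_pair_eq_circle`, roots `e^{i arg η / n}`).  Net statement
`minEnergyOn_homHubbardMag_crtSeam35/34/53/43`: for EVERY `η ∈ U(1)²` the one-seam twisted `3 × 5`
(`3 × 4`, `5 × 3`, `4 × 3`) torus has the sector ground energies of a uniformly twisted ring covered by
Part VIII — so the twist rows PP, PA, AP, AA (and every flux) of the CAL ceiling page are admissible data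
for `CAP(≤3,5)` / `CAP(≤3,4)` at kernel grade.  The numerical rows are ED references on the ceiling page,
not part of this file. [cite: Lieb1994, eq. (1)] [cite: ShastrySutherland1990] [cite: Gros1992]
-/

noncomputable section

open Matrix Finset
open Literature.MathematicalPhysics.QuantumLattice
open Literature.MathematicalPhysics.QuantumFieldTheory hiding Site
open Literature.MathematicalPhysics.QuantumManyBody.StateRelaxation
open Literature.Probability.LatticeModels
open HubbardWave0
open scoped ComplexOrder ComplexConjugate

namespace Summit.Ventures.CertifiedManyBodySolver.Rows
section Seam

/-! ### One-seam form of the uniformly twisted CRT rings (the ED convention) -/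

/-- **CRT-coordinate gauge** on the ring `ℤ/N` presenting `ℤ/a × ℤ/b` (`N = ab`, coordinates
`(s mod a, s mod b)`): `g(s) = κ₀^{s mod a} κ₁^{s mod b}`. [cite: Lieb1994, eq. (1)] -/
def crtGauge (N a b : ℕ) (κ : Fin 2 → Circle) (s : TorusSite 1 N) : Circle :=
  κ 0 ^ ((s 0).val % a) * κ 1 ^ ((s 0).val % b)

/-- **One-seam field** on the CRT ring with seam phases `η = (e^{iθ_x}, e^{iθ_y})`: phase `η₀` on the
`x`-hops leaving the last column (`s mod a = a − 1`), `η₁` on the `y`-hops leaving the last row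
(`s mod b = b − 1`), `1` on every other hop — the boundary-twist convention of exact diagonalisation
(periodic `= 1`, antiperiodic `= −1`). [cite: ShastrySutherland1990] [cite: Gros1992] -/
def crtSeam (N a b : ℕ) (η : Fin 2 → Circle) (s : TorusSite 1 N) : Fin 2 → Circle :=
  ![if (s 0).val % a = a - 1 then η 0 else 1, if (s 0).val % b = b - 1 then η 1 else 1]

/-- Every phase has an `n`-th root on the circle (`n ≥ 1`): `(e^{i arg η / n})^n = η`. [folklore] -/
theorem exists_pow_eq_circle (η : Circle) {n : ℕ} (hn : n ≠ 0) : ∃ κ : Circle, κ ^ n = η :=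
  ⟨Circle.exp (Complex.arg η / n), by
    rw [← Circle.exp_natCast_mul, mul_div_cancel₀ _ (Nat.cast_ne_zero.2 hn), Circle.exp_arg]⟩

/-- Every pair of seam phases is a pair of powers: `η = (κ₀^a, κ₁^b)` for some `κ` (`a, b ≥ 1`).
[folklore] -/
theorem exists_pow_pair_eq_circle (η : Fin 2 → Circle) {a b : ℕ} (ha : a ≠ 0) (hb : b ≠ 0) :
    ∃ κ : Fin 2 → Circle, (![κ 0 ^ a, κ 1 ^ b] : Fin 2 → Circle) = η := by
  obtain ⟨κ₀, h₀⟩ := exists_pow_eq_circle (η 0) ha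
  obtain ⟨κ₁, h₁⟩ := exists_pow_eq_circle (η 1) hb
  refine ⟨![κ₀, κ₁], funext fun i => ?_⟩
  fin_cases i
  · simpa using h₀
  · simpa using h₁

/-! ### `3 × 5` and `3 × 4` -/

/-- The hops of `crtHom35` on residues: `s ↦ s + 10`, `s ↦ s + 6` (values mod `15`). [folklore] -/
theorem val_add_crtHom35_unitVec (s : TorusSite 1 15) (i : Fin 2) :
    ((s + crtHom35 (unitVec i)) 0).val = ((s 0).val + (![10, 6] i : ℕ)) % 15 := by
  rw [Pi.add_apply, show crtHom35 = ringHom 15 ![10, 6] from rfl, ringHom_unitVec, ZMod.val_add]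
  congr 2
  fin_cases i <;> decide

/-- **Uniform field = one-seam twist on `3 × 5`** (`crtHom35`: ring `ℤ/15`, hops `+10 ≙ e_x` of order `3`,
`+6 ≙ e_y` of order `5`): the CRT-coordinate gauge `s ↦ κ₀^(s mod 3) κ₁^(s mod 5)` carries the uniform
field `κ` to the one-seam field with seam phases `(κ₀^3, κ₁^5)`. [cite: Lieb1994, eq. (1)] -/
theorem homGaugeTransform_crtGauge_crtHom35 (κ : Fin 2 → Circle) :
    homGaugeTransform crtHom35 (crtGauge 15 3 5 κ) (fun _ => κ) = crtSeam 15 3 5 ![κ 0 ^ 3, κ 1 ^ 5] := by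
  funext s i
  have hv : (s 0).val < 15 := ZMod.val_lt (s 0)
  simp only [homGaugeTransform, crtGauge, crtSeam]
  rw [val_add_crtHom35_unitVec]
  generalize (s 0).val = v at hv ⊢
  fin_cases i
  · simp only [Fin.zero_eta, Fin.isValue, Matrix.cons_val_zero]
    by_cases h : v % 3 = 3 - 1
    · have e1 : (v + 10) % 15 % 3 = 0 := by omega
      have e2 : (v + 10) % 15 % 5 = v % 5 := by omega
      rw [if_pos h, e1, e2, pow_zero, one_mul, show v % 3 = 2 by omega, mul_right_comm (κ 0 ^ 2),
        mul_inv_cancel_right, ← pow_succ]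
    · have e1 : (v + 10) % 15 % 3 = v % 3 + 1 := by omega
      have e2 : (v + 10) % 15 % 5 = v % 5 := by omega
      rw [if_neg h, e1, e2, pow_succ, mul_right_comm (κ 0 ^ (v % 3)) (κ 1 ^ (v % 5)) (κ 0), mul_inv_cancel]
  · simp only [Fin.mk_one, Fin.isValue, Matrix.cons_val_one, Matrix.cons_val_zero]
    by_cases h : v % 5 = 5 - 1
    · have e1 : (v + 6) % 15 % 3 = v % 3 := by omega
      have e2 : (v + 6) % 15 % 5 = 0 := by omega
      rw [if_pos h, e1, e2, pow_zero, mul_one, show v % 5 = 4 by omega, mul_assoc, mul_comm _ (κ 0 ^ (v % 3))⁻¹,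
        ← mul_assoc, mul_inv_cancel_comm, ← pow_succ]
    · have e1 : (v + 6) % 15 % 3 = v % 3 := by omega
      have e2 : (v + 6) % 15 % 5 = v % 5 + 1 := by omega
      rw [if_neg h, e1, e2, pow_succ, ← mul_assoc, mul_inv_cancel]

/-- Gauge covariance on `crtHom35`: the one-seam field with phases `(κ₀^3, κ₁^5)` and the uniform field `κ`
have the same sector ground energies. [cite: Lieb1994, eq. (1)] -/
theorem minEnergyOn_homHubbardMag_crtSeam35_pow (κ : Fin 2 → Circle) (t U : ℝ) (n : ℕ) (M : ℝ) :
    (homHubbardMag crtHom35 (crtSeam 15 3 5 ![κ 0 ^ 3, κ 1 ^ 5]) t U).minEnergyOn (szSector n M) =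
      (homHubbardMag crtHom35 (fun _ => κ) t U).minEnergyOn (szSector n M) := by
  rw [← homGaugeTransform_crtGauge_crtHom35, minEnergyOn_szSector_homGaugeTransform]

/-- **One-seam twisted `3 × 5` torus (`crtHom35`) = a uniformly twisted CRT ring**, for EVERY pair of seam
phases `η ∈ U(1)²` (`κ₀^3 = η₀`, `κ₁^5 = η₁`). [cite: Lieb1994, eq. (1)] [cite: Gros1992] -/
theorem minEnergyOn_homHubbardMag_crtSeam35 (η : Fin 2 → Circle) (t U : ℝ) (n : ℕ) (M : ℝ) :
    ∃ κ : Fin 2 → Circle, κ 0 ^ 3 = η 0 ∧ κ 1 ^ 5 = η 1 ∧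
      (homHubbardMag crtHom35 (crtSeam 15 3 5 η) t U).minEnergyOn (szSector n M) =
        (homHubbardMag crtHom35 (fun _ => κ) t U).minEnergyOn (szSector n M) := by
  obtain ⟨κ, hκ⟩ := exists_pow_pair_eq_circle η (a := 3) (b := 5) (by norm_num) (by norm_num)
  refine ⟨κ, by simpa using congrFun hκ 0, by simpa using congrFun hκ 1, ?_⟩
  rw [← hκ, minEnergyOn_homHubbardMag_crtSeam35_pow]

/-- The hops of `crtHom34` on residues: `s ↦ s + 4`, `s ↦ s + 9` (values mod `12`). [folklore] -/
theorem val_add_crtHom34_unitVec (s : TorusSite 1 12) (i : Fin 2) :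
    ((s + crtHom34 (unitVec i)) 0).val = ((s 0).val + (![4, 9] i : ℕ)) % 12 := by
  rw [Pi.add_apply, show crtHom34 = ringHom 12 ![4, 9] from rfl, ringHom_unitVec, ZMod.val_add]
  congr 2
  fin_cases i <;> decide

/-- **Uniform field = one-seam twist on `3 × 4`** (`crtHom34`: ring `ℤ/12`, hops `+4 ≙ e_x` of order `3`,
`+9 ≙ e_y` of order `4`): the CRT-coordinate gauge `s ↦ κ₀^(s mod 3) κ₁^(s mod 4)` carries the uniform
field `κ` to the one-seam field with seam phases `(κ₀^3, κ₁^4)`. [cite: Lieb1994, eq. (1)] -/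
theorem homGaugeTransform_crtGauge_crtHom34 (κ : Fin 2 → Circle) :
    homGaugeTransform crtHom34 (crtGauge 12 3 4 κ) (fun _ => κ) = crtSeam 12 3 4 ![κ 0 ^ 3, κ 1 ^ 4] := by
  funext s i
  have hv : (s 0).val < 12 := ZMod.val_lt (s 0)
  simp only [homGaugeTransform, crtGauge, crtSeam]
  rw [val_add_crtHom34_unitVec]
  generalize (s 0).val = v at hv ⊢
  fin_cases i
  · simp only [Fin.zero_eta, Fin.isValue, Matrix.cons_val_zero]
    by_cases h : v % 3 = 3 - 1
    · have e1 : (v + 4) % 12 % 3 = 0 := by omega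
      have e2 : (v + 4) % 12 % 4 = v % 4 := by omega
      rw [if_pos h, e1, e2, pow_zero, one_mul, show v % 3 = 2 by omega, mul_right_comm (κ 0 ^ 2),
        mul_inv_cancel_right, ← pow_succ]
    · have e1 : (v + 4) % 12 % 3 = v % 3 + 1 := by omega
      have e2 : (v + 4) % 12 % 4 = v % 4 := by omega
      rw [if_neg h, e1, e2, pow_succ, mul_right_comm (κ 0 ^ (v % 3)) (κ 1 ^ (v % 4)) (κ 0), mul_inv_cancel]
  · simp only [Fin.mk_one, Fin.isValue, Matrix.cons_val_one, Matrix.cons_val_zero]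
    by_cases h : v % 4 = 4 - 1
    · have e1 : (v + 9) % 12 % 3 = v % 3 := by omega
      have e2 : (v + 9) % 12 % 4 = 0 := by omega
      rw [if_pos h, e1, e2, pow_zero, mul_one, show v % 4 = 3 by omega, mul_assoc, mul_comm _ (κ 0 ^ (v % 3))⁻¹,
        ← mul_assoc, mul_inv_cancel_comm, ← pow_succ]
    · have e1 : (v + 9) % 12 % 3 = v % 3 := by omega
      have e2 : (v + 9) % 12 % 4 = v % 4 + 1 := by omega
      rw [if_neg h, e1, e2, pow_succ, ← mul_assoc, mul_inv_cancel]

/-- Gauge covariance on `crtHom34`: the one-seam field with phases `(κ₀^3, κ₁^4)` and the uniform field `κ`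
have the same sector ground energies. [cite: Lieb1994, eq. (1)] -/
theorem minEnergyOn_homHubbardMag_crtSeam34_pow (κ : Fin 2 → Circle) (t U : ℝ) (n : ℕ) (M : ℝ) :
    (homHubbardMag crtHom34 (crtSeam 12 3 4 ![κ 0 ^ 3, κ 1 ^ 4]) t U).minEnergyOn (szSector n M) =
      (homHubbardMag crtHom34 (fun _ => κ) t U).minEnergyOn (szSector n M) := by
  rw [← homGaugeTransform_crtGauge_crtHom34, minEnergyOn_szSector_homGaugeTransform]

/-- **One-seam twisted `3 × 4` torus (`crtHom34`) = a uniformly twisted CRT ring**, for EVERY pair of seam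
phases `η ∈ U(1)²` (`κ₀^3 = η₀`, `κ₁^4 = η₁`). [cite: Lieb1994, eq. (1)] [cite: Gros1992] -/
theorem minEnergyOn_homHubbardMag_crtSeam34 (η : Fin 2 → Circle) (t U : ℝ) (n : ℕ) (M : ℝ) :
    ∃ κ : Fin 2 → Circle, κ 0 ^ 3 = η 0 ∧ κ 1 ^ 4 = η 1 ∧
      (homHubbardMag crtHom34 (crtSeam 12 3 4 η) t U).minEnergyOn (szSector n M) =
        (homHubbardMag crtHom34 (fun _ => κ) t U).minEnergyOn (szSector n M) := by
  obtain ⟨κ, hκ⟩ := exists_pow_pair_eq_circle η (a := 3) (b := 4) (by norm_num) (by norm_num)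
  refine ⟨κ, by simpa using congrFun hκ 0, by simpa using congrFun hκ 1, ?_⟩
  rw [← hκ, minEnergyOn_homHubbardMag_crtSeam34_pow]

/-! ### The transposed presentations `5 × 3` (`crtHom53`) and `4 × 3` (`crtHom43`) -/

/-- The hops of `crtHom53` on residues: `s ↦ s + 6`, `s ↦ s + 10` (values mod `15`). [folklore] -/
theorem val_add_crtHom53_unitVec (s : TorusSite 1 15) (i : Fin 2) :
    ((s + crtHom53 (unitVec i)) 0).val = ((s 0).val + (![6, 10] i : ℕ)) % 15 := by
  rw [Pi.add_apply, show crtHom53 = ringHom 15 ![6, 10] from rfl, ringHom_unitVec, ZMod.val_add]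
  congr 2
  fin_cases i <;> decide

/-- **Uniform field = one-seam twist on `5 × 3`** (`crtHom53`: ring `ℤ/15`, hops `+6 ≙ e_x` of order `5`,
`+10 ≙ e_y` of order `3`): the CRT-coordinate gauge `s ↦ κ₀^(s mod 5) κ₁^(s mod 3)` carries the uniform
field `κ` to the one-seam field with seam phases `(κ₀^5, κ₁^3)`. [cite: Lieb1994, eq. (1)] -/
theorem homGaugeTransform_crtGauge_crtHom53 (κ : Fin 2 → Circle) :
    homGaugeTransform crtHom53 (crtGauge 15 5 3 κ) (fun _ => κ) = crtSeam 15 5 3 ![κ 0 ^ 5, κ 1 ^ 3] := by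
  funext s i
  have hv : (s 0).val < 15 := ZMod.val_lt (s 0)
  simp only [homGaugeTransform, crtGauge, crtSeam]
  rw [val_add_crtHom53_unitVec]
  generalize (s 0).val = v at hv ⊢
  fin_cases i
  · simp only [Fin.zero_eta, Fin.isValue, Matrix.cons_val_zero]
    by_cases h : v % 5 = 5 - 1
    · have e1 : (v + 6) % 15 % 5 = 0 := by omega
      have e2 : (v + 6) % 15 % 3 = v % 3 := by omega
      rw [if_pos h, e1, e2, pow_zero, one_mul, show v % 5 = 4 by omega, mul_right_comm (κ 0 ^ 4),
        mul_inv_cancel_right, ← pow_succ]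
    · have e1 : (v + 6) % 15 % 5 = v % 5 + 1 := by omega
      have e2 : (v + 6) % 15 % 3 = v % 3 := by omega
      rw [if_neg h, e1, e2, pow_succ, mul_right_comm (κ 0 ^ (v % 5)) (κ 1 ^ (v % 3)) (κ 0), mul_inv_cancel]
  · simp only [Fin.mk_one, Fin.isValue, Matrix.cons_val_one, Matrix.cons_val_zero]
    by_cases h : v % 3 = 3 - 1
    · have e1 : (v + 10) % 15 % 5 = v % 5 := by omega
      have e2 : (v + 10) % 15 % 3 = 0 := by omega
      rw [if_pos h, e1, e2, pow_zero, mul_one, show v % 3 = 2 by omega, mul_assoc, mul_comm _ (κ 0 ^ (v % 5))⁻¹,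
        ← mul_assoc, mul_inv_cancel_comm, ← pow_succ]
    · have e1 : (v + 10) % 15 % 5 = v % 5 := by omega
      have e2 : (v + 10) % 15 % 3 = v % 3 + 1 := by omega
      rw [if_neg h, e1, e2, pow_succ, ← mul_assoc, mul_inv_cancel]

/-- Gauge covariance on `crtHom53`: the one-seam field with phases `(κ₀^5, κ₁^3)` and the uniform field `κ`
have the same sector ground energies. [cite: Lieb1994, eq. (1)] -/
theorem minEnergyOn_homHubbardMag_crtSeam53_pow (κ : Fin 2 → Circle) (t U : ℝ) (n : ℕ) (M : ℝ) :
    (homHubbardMag crtHom53 (crtSeam 15 5 3 ![κ 0 ^ 5, κ 1 ^ 3]) t U).minEnergyOn (szSector n M) =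
      (homHubbardMag crtHom53 (fun _ => κ) t U).minEnergyOn (szSector n M) := by
  rw [← homGaugeTransform_crtGauge_crtHom53, minEnergyOn_szSector_homGaugeTransform]

/-- **One-seam twisted `5 × 3` torus (`crtHom53`) = a uniformly twisted CRT ring**, for EVERY pair of seam
phases `η ∈ U(1)²` (`κ₀^5 = η₀`, `κ₁^3 = η₁`). [cite: Lieb1994, eq. (1)] [cite: Gros1992] -/
theorem minEnergyOn_homHubbardMag_crtSeam53 (η : Fin 2 → Circle) (t U : ℝ) (n : ℕ) (M : ℝ) :
    ∃ κ : Fin 2 → Circle, κ 0 ^ 5 = η 0 ∧ κ 1 ^ 3 = η 1 ∧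
      (homHubbardMag crtHom53 (crtSeam 15 5 3 η) t U).minEnergyOn (szSector n M) =
        (homHubbardMag crtHom53 (fun _ => κ) t U).minEnergyOn (szSector n M) := by
  obtain ⟨κ, hκ⟩ := exists_pow_pair_eq_circle η (a := 5) (b := 3) (by norm_num) (by norm_num)
  refine ⟨κ, by simpa using congrFun hκ 0, by simpa using congrFun hκ 1, ?_⟩
  rw [← hκ, minEnergyOn_homHubbardMag_crtSeam53_pow]

/-- The hops of `crtHom43` on residues: `s ↦ s + 9`, `s ↦ s + 4` (values mod `12`). [folklore] -/
theorem val_add_crtHom43_unitVec (s : TorusSite 1 12) (i : Fin 2) :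
    ((s + crtHom43 (unitVec i)) 0).val = ((s 0).val + (![9, 4] i : ℕ)) % 12 := by
  rw [Pi.add_apply, show crtHom43 = ringHom 12 ![9, 4] from rfl, ringHom_unitVec, ZMod.val_add]
  congr 2
  fin_cases i <;> decide

/-- **Uniform field = one-seam twist on `4 × 3`** (`crtHom43`: ring `ℤ/12`, hops `+9 ≙ e_x` of order `4`,
`+4 ≙ e_y` of order `3`): the CRT-coordinate gauge `s ↦ κ₀^(s mod 4) κ₁^(s mod 3)` carries the uniform
field `κ` to the one-seam field with seam phases `(κ₀^4, κ₁^3)`. [cite: Lieb1994, eq. (1)] -/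
theorem homGaugeTransform_crtGauge_crtHom43 (κ : Fin 2 → Circle) :
    homGaugeTransform crtHom43 (crtGauge 12 4 3 κ) (fun _ => κ) = crtSeam 12 4 3 ![κ 0 ^ 4, κ 1 ^ 3] := by
  funext s i
  have hv : (s 0).val < 12 := ZMod.val_lt (s 0)
  simp only [homGaugeTransform, crtGauge, crtSeam]
  rw [val_add_crtHom43_unitVec]
  generalize (s 0).val = v at hv ⊢
  fin_cases i
  · simp only [Fin.zero_eta, Fin.isValue, Matrix.cons_val_zero]
    by_cases h : v % 4 = 4 - 1
    · have e1 : (v + 9) % 12 % 4 = 0 := by omega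
      have e2 : (v + 9) % 12 % 3 = v % 3 := by omega
      rw [if_pos h, e1, e2, pow_zero, one_mul, show v % 4 = 3 by omega, mul_right_comm (κ 0 ^ 3),
        mul_inv_cancel_right, ← pow_succ]
    · have e1 : (v + 9) % 12 % 4 = v % 4 + 1 := by omega
      have e2 : (v + 9) % 12 % 3 = v % 3 := by omega
      rw [if_neg h, e1, e2, pow_succ, mul_right_comm (κ 0 ^ (v % 4)) (κ 1 ^ (v % 3)) (κ 0), mul_inv_cancel]
  · simp only [Fin.mk_one, Fin.isValue, Matrix.cons_val_one, Matrix.cons_val_zero]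
    by_cases h : v % 3 = 3 - 1
    · have e1 : (v + 4) % 12 % 4 = v % 4 := by omega
      have e2 : (v + 4) % 12 % 3 = 0 := by omega
      rw [if_pos h, e1, e2, pow_zero, mul_one, show v % 3 = 2 by omega, mul_assoc, mul_comm _ (κ 0 ^ (v % 4))⁻¹,
        ← mul_assoc, mul_inv_cancel_comm, ← pow_succ]
    · have e1 : (v + 4) % 12 % 4 = v % 4 := by omega
      have e2 : (v + 4) % 12 % 3 = v % 3 + 1 := by omega
      rw [if_neg h, e1, e2, pow_succ, ← mul_assoc, mul_inv_cancel]

/-- Gauge covariance on `crtHom43`: the one-seam field with phases `(κ₀^4, κ₁^3)` and the uniform field `κ`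
have the same sector ground energies. [cite: Lieb1994, eq. (1)] -/
theorem minEnergyOn_homHubbardMag_crtSeam43_pow (κ : Fin 2 → Circle) (t U : ℝ) (n : ℕ) (M : ℝ) :
    (homHubbardMag crtHom43 (crtSeam 12 4 3 ![κ 0 ^ 4, κ 1 ^ 3]) t U).minEnergyOn (szSector n M) =
      (homHubbardMag crtHom43 (fun _ => κ) t U).minEnergyOn (szSector n M) := by
  rw [← homGaugeTransform_crtGauge_crtHom43, minEnergyOn_szSector_homGaugeTransform]

/-- **One-seam twisted `4 × 3` torus (`crtHom43`) = a uniformly twisted CRT ring**, for EVERY pair of seam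
phases `η ∈ U(1)²` (`κ₀^4 = η₀`, `κ₁^3 = η₁`). [cite: Lieb1994, eq. (1)] [cite: Gros1992] -/
theorem minEnergyOn_homHubbardMag_crtSeam43 (η : Fin 2 → Circle) (t U : ℝ) (n : ℕ) (M : ℝ) :
    ∃ κ : Fin 2 → Circle, κ 0 ^ 4 = η 0 ∧ κ 1 ^ 3 = η 1 ∧
      (homHubbardMag crtHom43 (crtSeam 12 4 3 η) t U).minEnergyOn (szSector n M) =
        (homHubbardMag crtHom43 (fun _ => κ) t U).minEnergyOn (szSector n M) := by
  obtain ⟨κ, hκ⟩ := exists_pow_pair_eq_circle η (a := 4) (b := 3) (by norm_num) (by norm_num)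
  refine ⟨κ, by simpa using congrFun hκ 0, by simpa using congrFun hκ 1, ?_⟩
  rw [← hκ, minEnergyOn_homHubbardMag_crtSeam43_pow]

end Seam

end Summit.Ventures.CertifiedManyBodySolver.Rows

end
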